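import Literature.MathematicalPhysics.QuantumFieldTheory.ConformalBootstrap3D.PointKernelK34L505Data
import Literature.MathematicalPhysics.QuantumFieldTheory.ConformalBootstrap3D.PointKernelK34L505Segs
import Literature.MathematicalPhysics.QuantumFieldTheory.ConformalBootstrap3D.PointKernelParts

/-!
# K34L505 certificate, kernel part file P52: one-cell head segments 115, 116, 117 in level ranges

The head cells whose kernel evaluation exceeds one `decide` are one-cell segments of `hsegsK34L505`; each is
checked by `PCert.hPartSideOK` (side conditions) and `PCert.hPartOK` per level range `[n_lo, n_lo + count)`
against an integer claim, the claims summing to `≥ 0` (`PointKernel.partsOK`); soundness is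
`PCert.hParts_sound` (`PointKernelParts`).  The part files are mutually independent (each imports only
the data file); the ranges of one cell may span several of them, and the per-cell conclusions
`hparts_i` / `hcell_i` of those cells are assembled in `PointKernelK34L505.lean`.
Estimated kernel time 254 s.
-/

set_option maxRecDepth 100000
set_option maxHeartbeats 0

namespace Literature.MathematicalPhysics.QuantumFieldTheory.ConformalBootstrap3D.PointKernelK34L505

open Literature.MathematicalPhysics.QuantumFieldTheory.ConformalBootstrap3D.PointKernel

/-- levels `[31, 44)` of segment 115: partial lower sum `≥` claim. [folklore] -/
theorem part_115_1 : certK34L505.hPartOK (PCert.segAt hsegsK34L505 115) JHK34L505 31 13 (11415780581213300070608199581529267084) = true := by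
  decide +kernel

/-- levels `[44, 49)` of segment 115: partial lower sum `≥` claim. [folklore] -/
theorem part_115_2 : certK34L505.hPartOK (PCert.segAt hsegsK34L505 115) JHK34L505 44 5 (1358393850904435723511615420244903216) = true := by
  decide +kernel

/-- one-cell segment 116 (row 6, cell `[1799/256, 225/32]`, chord, `n_F = 48`,
3 level ranges): side conditions. [folklore] -/
theorem pside_116 : certK34L505.hPartSideOK (PCert.segAt hsegsK34L505 116) JHK34L505 = true := by
  decide +kernel

/-- its level ranges `(n_lo, count, claim)`. [folklore] -/
def partsK34L505_116 : List (ℕ × ℕ × ℤ) := [(0, 31, -11960411602274946030046449927795809423), (31, 13, 11021592917894399743917682111946775144), (44, 5, 938818684380546286128767815849034281)]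

/-- the ranges tile `[0, n_F]` and the claims sum to `≥ 0`. [folklore] -/
theorem pcov_116 : PointKernel.partsOK 48 partsK34L505_116 = true := by
  decide +kernel

/-- levels `[0, 31)` of segment 116: partial lower sum `≥` claim. [folklore] -/
theorem part_116_0 : certK34L505.hPartOK (PCert.segAt hsegsK34L505 116) JHK34L505 0 31 (-11960411602274946030046449927795809423) = true := by
  decide +kernel

/-- levels `[31, 44)` of segment 116: partial lower sum `≥` claim. [folklore] -/
theorem part_116_1 : certK34L505.hPartOK (PCert.segAt hsegsK34L505 116) JHK34L505 31 13 (11021592917894399743917682111946775144) = true := by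
  decide +kernel

/-- levels `[44, 49)` of segment 116: partial lower sum `≥` claim. [folklore] -/
theorem part_116_2 : certK34L505.hPartOK (PCert.segAt hsegsK34L505 116) JHK34L505 44 5 (938818684380546286128767815849034281) = true := by
  decide +kernel

/-- one-cell segment 117 (row 6, cell `[225/32, 1801/256]`, chord, `n_F = 40`,
2 level ranges): side conditions. [folklore] -/
theorem pside_117 : certK34L505.hPartSideOK (PCert.segAt hsegsK34L505 117) JHK34L505 = true := by
  decide +kernel

/-- its level ranges `(n_lo, count, claim)`. [folklore] -/
def partsK34L505_117 : List (ℕ × ℕ × ℤ) := [(0, 32, -8627637495442924764908040063661291319), (32, 9, 8627637495442924764908040063661291319)]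

/-- the ranges tile `[0, n_F]` and the claims sum to `≥ 0`. [folklore] -/
theorem pcov_117 : PointKernel.partsOK 40 partsK34L505_117 = true := by
  decide +kernel

end Literature.MathematicalPhysics.QuantumFieldTheory.ConformalBootstrap3D.PointKernelK34L505
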